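import Mathlib.Topology.ContinuousMap.Weierstrass
import Mathlib.MeasureTheory.Measure.HasOuterApproxClosed
import Mathlib.MeasureTheory.Integral.Bochner.Set
import Mathlib.Analysis.SpecialFunctions.Log.Basic
import Mathlib.MeasureTheory.Measure.WithDensity

/-!
# A measure on `[0,∞)` is determined by its Laplace transform

A positive measure `μ` on `[0,∞)` whose Laplace transform `ℒμ(t) = ∫ e^{-ta} dμ(a)` is finite at
`t = 1` is determined by the values `ℒμ(n)`, `n = 1, 2, …` — the uniqueness input of the
identification of the spectral measure of the Gaussian free field in H. Duminil-Copin,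
K. K. Kozlowski, P. Lammers, I. Manolescu, arXiv:2603.06268 (2026), proof of Theorem 53 ("Since a
`σ`-finite positive measure is uniquely determined by its Laplace transform, this identifies `μ`").
[DKLM2026SixVertexGFF]

Proof: the finite measures `e^{-a} μ` pushed forward by `a ↦ e^{-a}` live on `[0,1]`, have the
moments `ℒμ(n+1)`, hence equal integrals of polynomials, hence (Weierstrass) of all bounded
continuous functions, hence coincide; the construction is undone by `u ↦ -log u` and the density
`e^{a}`.

* `Measure.ext_of_forall_lintegral_exp_neg_nat_mul_eq` — the uniqueness theorem.

## References

* W. Feller, *An Introduction to Probability Theory and its Applications*, Vol. II, 2nd ed., Wiley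
  (1971), XIII.1, Theorem 1 (uniqueness for Laplace transforms); folklore. H. Duminil-Copin et al.,
  arXiv:2603.06268, proof of Theorem 53. [DKLM2026SixVertexGFF]
-/

noncomputable section

open MeasureTheory Set Filter Topology Polynomial

namespace Literature.MeasureTheory.Integral

/-! ## 1. The tilted, pushed-forward finite measures -/

/-- The density `e^{-a}`. [folklore] -/
def expNegDensity (a : ℝ) : ENNReal := ENNReal.ofReal (Real.exp (-a))

/-- The inverse density `e^{a}`. [folklore] -/
def expDensity (a : ℝ) : ENNReal := ENNReal.ofReal (Real.exp a)

/-- `e^{-a}` is measurable. [folklore] -/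
theorem measurable_expNegDensity : Measurable expNegDensity :=
  (Real.measurable_exp.comp measurable_neg).ennreal_ofReal

/-- `e^{a}` is measurable. [folklore] -/
theorem measurable_expDensity : Measurable expDensity := Real.measurable_exp.ennreal_ofReal

/-- `e^{-a} e^{a} = 1`. [folklore] -/
theorem expNegDensity_mul_expDensity : expNegDensity * expDensity = 1 := by
  funext a
  simp only [Pi.mul_apply, Pi.one_apply, expNegDensity, expDensity]
  rw [← ENNReal.ofReal_mul (Real.exp_pos _).le, ← Real.exp_add, neg_add_cancel, Real.exp_zero, ENNReal.ofReal_one]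

/-- Undoing the tilt: `(e^{-a} μ) · e^{a} = μ`. [folklore] -/
theorem withDensity_expNeg_withDensity_exp (μ : Measure ℝ) :
    (μ.withDensity expNegDensity).withDensity expDensity = μ := by
  rw [← withDensity_mul _ measurable_expNegDensity measurable_expDensity, expNegDensity_mul_expDensity, withDensity_one]

/-- The map `a ↦ e^{-a}` and its left inverse `u ↦ -log u`. [folklore] -/
theorem neg_log_exp_neg : (fun u : ℝ => -Real.log u) ∘ (fun a : ℝ => Real.exp (-a)) = id := by
  funext a; simp

/-! ## 2. Moments of the pushed-forward measure are Laplace transforms -/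

/-- `∫ u^n d((e^{-a}μ) ∘ (e^{-·})⁻¹) = ∫ e^{-(n+1)a} dμ` (as Lebesgue integrals of nonnegative functions,
for a measure carried by `[0,∞)`). [folklore] -/
theorem lintegral_pow_map_exp_neg (μ : Measure ℝ) (n : ℕ) :
    ∫⁻ u, ENNReal.ofReal (u ^ n) ∂(μ.withDensity expNegDensity).map (fun a : ℝ => Real.exp (-a)) =
      ∫⁻ a, ENNReal.ofReal (Real.exp (-((n + 1 : ℝ) * a))) ∂μ := by
  rw [lintegral_map (show Measurable (fun u : ℝ => ENNReal.ofReal (u ^ n)) from (measurable_id.pow_const n).ennreal_ofReal)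
      (show Measurable (fun a : ℝ => Real.exp (-a)) from Real.measurable_exp.comp measurable_neg),
    lintegral_withDensity_eq_lintegral_mul _ measurable_expNegDensity
      (show Measurable (fun a : ℝ => ENNReal.ofReal (Real.exp (-a) ^ n)) from
        ((Real.measurable_exp.comp measurable_neg).pow_const n).ennreal_ofReal)]
  refine lintegral_congr fun a => ?_
  simp only [Pi.mul_apply, expNegDensity]
  rw [← ENNReal.ofReal_mul (Real.exp_pos _).le, ← Real.exp_nat_mul, ← Real.exp_add]
  congr 2
  ring

/-! ## 3. Finite measures on `[0,1]` with equal moments are equal -/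

/-- Polynomials integrate equally against two finite measures on `ℝ` with equal moments (the monomials
being integrable). [folklore] -/
theorem integral_polynomial_eq_of_moments_eq {P Q : Measure ℝ}
    (hint : ∀ n : ℕ, Integrable (fun u : ℝ => u ^ n) P) (hint' : ∀ n : ℕ, Integrable (fun u : ℝ => u ^ n) Q)
    (hmom : ∀ n : ℕ, ∫ u, u ^ n ∂P = ∫ u, u ^ n ∂Q) (p : ℝ[X]) :
    ∫ u, p.eval u ∂P = ∫ u, p.eval u ∂Q := by
  simp_rw [Polynomial.eval_eq_sum_range]
  rw [integral_finsetSum _ fun i _ => (hint i).const_mul _, integral_finsetSum _ fun i _ => (hint' i).const_mul _]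
  refine Finset.sum_congr rfl fun i _ => ?_
  rw [integral_const_mul, integral_const_mul, hmom i]

/-- A continuous function is integrable against a finite measure carried by `[0,1]`. [folklore] -/
theorem integrable_of_continuous_of_Icc {R : Measure ℝ} [IsFiniteMeasure R] (hR : R (Icc 0 1)ᶜ = 0) {g : ℝ → ℝ}
    (hg : Continuous g) : Integrable g R := by
  obtain ⟨B, hB⟩ := isCompact_Icc.exists_bound_of_continuousOn (hg.continuousOn (s := Icc (0 : ℝ) 1))
  have hRr : R.restrict (Icc 0 1) = R := Measure.restrict_eq_self_of_ae_mem (mem_ae_iff.2 hR)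
  rw [← hRr]
  exact Measure.integrableOn_of_bounded (measure_ne_top _ _) hg.aestronglyMeasurable
    (ae_restrict_of_forall_mem measurableSet_Icc hB)

/-- **Finite measures carried by `[0,1]` with equal moments coincide** (Weierstrass approximation and
`ext_of_forall_integral_eq_of_IsFiniteMeasure`). [folklore] -/
theorem measure_eq_of_moments_eq_of_Icc {P Q : Measure ℝ} [IsFiniteMeasure P] [IsFiniteMeasure Q]
    (hP : P (Icc 0 1)ᶜ = 0) (hQ : Q (Icc 0 1)ᶜ = 0)
    (hmom : ∀ n : ℕ, ∫ u, u ^ n ∂P = ∫ u, u ^ n ∂Q) : P = Q := by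
  have hpoly : ∀ p : ℝ[X], ∫ u, p.eval u ∂P = ∫ u, p.eval u ∂Q :=
    integral_polynomial_eq_of_moments_eq (fun n => integrable_of_continuous_of_Icc hP (continuous_id.pow n))
      (fun n => integrable_of_continuous_of_Icc hQ (continuous_id.pow n)) hmom
  have haeP : ∀ᵐ u ∂P, u ∈ Icc (0 : ℝ) 1 := mem_ae_iff.2 hP
  have haeQ : ∀ᵐ u ∂Q, u ∈ Icc (0 : ℝ) 1 := mem_ae_iff.2 hQ
  refine ext_of_forall_integral_eq_of_IsFiniteMeasure fun f => ?_
  -- `ε`-approximation by a polynomial on `[0,1]`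
  have key : ∀ ε : ℝ, 0 < ε → |∫ u, f u ∂P - ∫ u, f u ∂Q| ≤ ε * (P.real univ + Q.real univ) := by
    intro ε hε
    obtain ⟨p, hp⟩ := exists_polynomial_near_of_continuousOn 0 1 f f.continuous.continuousOn ε hε
    have hfP := integrable_of_continuous_of_Icc hP f.continuous
    have hfQ := integrable_of_continuous_of_Icc hQ f.continuous
    have hpP := integrable_of_continuous_of_Icc hP (p.continuous)
    have hpQ := integrable_of_continuous_of_Icc hQ (p.continuous)
    have e1 : ∫ u, f u ∂P - ∫ u, f u ∂Q =
        (∫ u, (f u - p.eval u) ∂P) - (∫ u, (f u - p.eval u) ∂Q) := by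
      rw [integral_sub hfP hpP, integral_sub hfQ hpQ, hpoly p]; ring
    rw [e1]
    have bP : ‖∫ u, (f u - p.eval u) ∂P‖ ≤ ε * P.real univ := by
      refine norm_integral_le_of_norm_le_const ?_
      filter_upwards [haeP] with u hu
      rw [Real.norm_eq_abs, abs_sub_comm]
      exact (hp u hu).le
    have bQ : ‖∫ u, (f u - p.eval u) ∂Q‖ ≤ ε * Q.real univ := by
      refine norm_integral_le_of_norm_le_const ?_
      filter_upwards [haeQ] with u hu
      rw [Real.norm_eq_abs, abs_sub_comm]
      exact (hp u hu).le
    rw [Real.norm_eq_abs] at bP bQ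
    calc |(∫ u, (f u - p.eval u) ∂P) - ∫ u, (f u - p.eval u) ∂Q|
        ≤ |∫ u, (f u - p.eval u) ∂P| + |∫ u, (f u - p.eval u) ∂Q| := abs_sub _ _
      _ ≤ ε * P.real univ + ε * Q.real univ := add_le_add bP bQ
      _ = ε * (P.real univ + Q.real univ) := by ring
  -- conclude
  have hK : 0 ≤ P.real univ + Q.real univ := by positivity
  refine eq_of_abs_sub_eq_zero (le_antisymm ?_ (abs_nonneg _))
  by_contra hcon
  push Not at hcon
  have := key (|∫ u, f u ∂P - ∫ u, f u ∂Q| / (2 * (P.real univ + Q.real univ + 1))) (by positivity)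
  rw [div_mul_eq_mul_div, le_div_iff₀ (by positivity)] at this
  nlinarith [abs_nonneg (∫ u, f u ∂P - ∫ u, f u ∂Q)]

/-! ## 4. Uniqueness for Laplace transforms -/

/-- **A measure on `[0,∞)` is determined by its Laplace transform** (at the positive integers): if
`μ, ν` are carried by `[0,∞)`, have `∫ e^{-a} dμ, ∫ e^{-a} dν < ∞`, and `∫ e^{-(n+1)a} dμ = ∫ e^{-(n+1)a} dν`
for all `n ∈ ℕ`, then `μ = ν`. [folklore] -/
theorem ext_of_forall_lintegral_exp_neg_nat_mul_eq {μ ν : Measure ℝ} (hμ0 : μ (Iio 0) = 0) (hν0 : ν (Iio 0) = 0)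
    (hμ1 : ∫⁻ a, ENNReal.ofReal (Real.exp (-a)) ∂μ ≠ ⊤) (hν1 : ∫⁻ a, ENNReal.ofReal (Real.exp (-a)) ∂ν ≠ ⊤)
    (h : ∀ n : ℕ, ∫⁻ a, ENNReal.ofReal (Real.exp (-((n + 1 : ℝ) * a))) ∂μ =
      ∫⁻ a, ENNReal.ofReal (Real.exp (-((n + 1 : ℝ) * a))) ∂ν) : μ = ν := by
  have hφ : Measurable (fun a : ℝ => Real.exp (-a)) := Real.measurable_exp.comp measurable_neg
  have hψ : Measurable (fun u : ℝ => -Real.log u) := Real.measurable_log.neg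
  -- the tilted pushed-forward measures
  set P : Measure ℝ := (μ.withDensity expNegDensity).map (fun a : ℝ => Real.exp (-a)) with hPdef
  set Q : Measure ℝ := (ν.withDensity expNegDensity).map (fun a : ℝ => Real.exp (-a)) with hQdef
  -- finiteness
  have hfin : ∀ (ρ : Measure ℝ), ∫⁻ a, ENNReal.ofReal (Real.exp (-a)) ∂ρ ≠ ⊤ →
      IsFiniteMeasure ((ρ.withDensity expNegDensity).map (fun a : ℝ => Real.exp (-a))) := by
    intro ρ hρ
    refine ⟨?_⟩
    rw [Measure.map_apply hφ MeasurableSet.univ, preimage_univ, withDensity_apply _ MeasurableSet.univ,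
      Measure.restrict_univ]
    exact lt_top_iff_ne_top.2 hρ
  haveI : IsFiniteMeasure P := hfin μ hμ1
  haveI : IsFiniteMeasure Q := hfin ν hν1
  -- carried by `[0,1]`
  have hcar : ∀ (ρ : Measure ℝ), ρ (Iio 0) = 0 →
      ((ρ.withDensity expNegDensity).map (fun a : ℝ => Real.exp (-a))) (Icc 0 1)ᶜ = 0 := by
    intro ρ hρ
    rw [Measure.map_apply hφ measurableSet_Icc.compl]
    refine withDensity_absolutelyContinuous _ _ (measure_mono_null (fun a ha => ?_) hρ)
    simp only [mem_preimage, mem_compl_iff, mem_Icc, not_and, not_le] at ha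
    by_contra hge
    rw [mem_Iio, not_lt] at hge
    have := ha (Real.exp_pos _).le
    have h1 : Real.exp (-a) ≤ 1 := Real.exp_le_one_iff.2 (by linarith)
    linarith
  -- equal moments
  have hmom : ∀ n : ℕ, ∫ u, u ^ n ∂P = ∫ u, u ^ n ∂Q := by
    intro n
    have hnn : ∀ (ρ : Measure ℝ), ρ (Icc (0 : ℝ) 1)ᶜ = 0 → 0 ≤ᵐ[ρ] fun u : ℝ => u ^ n := fun ρ hρ => by
      filter_upwards [(mem_ae_iff.2 hρ : ∀ᵐ u ∂ρ, u ∈ Icc (0 : ℝ) 1)] with u hu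
      exact pow_nonneg hu.1 n
    rw [integral_eq_lintegral_of_nonneg_ae (hnn P (hcar μ hμ0)) (continuous_id.pow n).aestronglyMeasurable,
      integral_eq_lintegral_of_nonneg_ae (hnn Q (hcar ν hν0)) (continuous_id.pow n).aestronglyMeasurable,
      hPdef, hQdef, lintegral_pow_map_exp_neg, lintegral_pow_map_exp_neg, h n]
  have hPQ : P = Q := measure_eq_of_moments_eq_of_Icc (hcar μ hμ0) (hcar ν hν0) hmom
  -- undo the push-forward and the tilt
  have hback : ∀ ρ : Measure ℝ, ((ρ.withDensity expNegDensity).map (fun a : ℝ => Real.exp (-a))).map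
      (fun u : ℝ => -Real.log u) = ρ.withDensity expNegDensity := fun ρ => by
    rw [Measure.map_map hψ hφ, neg_log_exp_neg, Measure.map_id]
  have htilt : μ.withDensity expNegDensity = ν.withDensity expNegDensity := by
    rw [← hback μ, ← hback ν]
    exact congrArg _ hPQ
  rw [← withDensity_expNeg_withDensity_exp μ, ← withDensity_expNeg_withDensity_exp ν, htilt]

end Literature.MeasureTheory.Integral

end
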